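import Mathlib
import HarnessLib
import Summits.Ventures.LatticeQCDFlow.Scoring.SplitChainDependsOn

/-!
# Gaps of the split chain: no head in `g` consecutive updates has weight `(1 − ε)^g` given any past,
# and whatever follows a gap that DID contain a head is bounded by the worst fresh start

HONEST FRAMING: exact (Metropolis-corrected) sampling algorithms for lattice gauge theory;
figures of merit are autocorrelation/cost numbers at stated couplings and volumes; no
continuum-physics claim.

Venture `LatticeQCDFlow` (cell pub-lqcd), topic `Scoring`; FANOUT row 8 (`s0-cpn-nemc`, GEN-15).
NEW WORK of the cell, not a published result; no definition is introduced.  With the fixed-time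
regeneration theorem of `Scoring/SplitChainPathLaw.lean` in its `DependsOn` form
(`Scoring/SplitChainDependsOn.lean`), this file proves the two facts a block / gap argument needs
about the split chain of a Doeblin kernel `κ(x, ·) ≥ ε ν` (`ε < 1`): (i) conditionally on any
weighted past, `g` consecutive tails have weight exactly `(1 − ε)^g`; (ii) THE GAP LEMMA: for a
nonnegative functional `H` of the state path observed from time `b + g + 1` on (after a gap of `g`
updates following time `b`) and a nonnegative weight `G` depending on the past up to `b`,
`E[G · 1{some head in the gap} · H] ≤ q · E[G]` as soon as `E_{P_{ν,κ}}[H ∘ θ_e] ≤ q` for every delay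
`1 ≤ e ≤ g` — decompose according to the FIRST head in the gap; after it the states are a fresh
`κ`-chain from `ν` seen with delay `e`.  Printed counterpart NAMED ONLY: first-entrance / first-
regeneration decompositions (Meyn–Tweedie 1993 §8.2, Nummelin 1984 Ch. 4); nothing is cited.

## Content (notation of `Scoring/SplitChain.lean`; `e = ε.toReal`; the tails product
## `T_{b,d}(x̂) = ∏_{i<d} 1{coin_{b+i+1} = tails}` and the head indicator are written inline)

* `measurable_coinHeads`, `measurable_coinTails`, `measurable_tailsProd`, `tailsProd_nonneg`,
  `tailsProd_le_one`, `dependsOn_tailsProd`, `tailsProd_succ_first` — bookkeeping;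
* **`splitChain_tailsRun`** — `E[G(X̂) · T_{b,d}(X̂)] = (1 − e)^d · E[G(X̂)]` for bounded measurable
  `G` with `DependsOn G (Set.Iic b)`: no regeneration in `d` consecutive updates has conditional
  probability exactly `(1 − ε)^d`;
* **`splitChain_gap_le`** — THE GAP LEMMA: `G ≥ 0` bounded measurable with `DependsOn G (Set.Iic b)`,
  `H ≥ 0` bounded measurable on state paths, `q ≥ 0` with `E_{P_{ν,κ}}[H((y_{e+n})_n)] ≤ q` for
  `1 ≤ e ≤ g`, and `s = b + g + 1`:
  `E[G(X̂) · (1 − T_{b,g}(X̂)) · H((X_{s+n})_n)] ≤ q · (1 − (1 − e)^g) · E[G(X̂)] ≤ q · E[G(X̂)]`.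

Reading (value-free): a block that starts after a gap of `g` updates containing at least one
regeneration behaves, given everything before the gap, no worse than the worst of `g` fresh starts
from `ν` — the any-start certificates of the row bound exactly such fresh starts; the complementary
event costs `(1 − ε)^g`.  NOT CLAIMED: anything at random (stopping) times; any `ε` of a concrete
sampler; the assembly into a median-of-blocks bound (separate file).
-/

noncomputable section

namespace Summit.Ventures.LatticeQCDFlow.Scoring

open MeasureTheory ProbabilityTheory Filter Finset Preorder Literature.Probability.MarkovChains
open scoped ENNReal

variable {Ω : Type*} [MeasurableSpace Ω]

/-! ### Bookkeeping: head / tails indicators and the tails product -/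

section Bookkeeping

/-- The head indicator at time `t` is measurable. -/
theorem measurable_coinHeads (t : ℕ) :
    Measurable fun x : ℕ → Ω × Bool => (if (x t).2 then (1 : ℝ) else 0) := by
  refine Measurable.ite ?_ measurable_const measurable_const
  exact (measurable_snd.comp (measurable_pi_apply _)) (measurableSet_singleton true)

/-- The tails indicator at time `t` is measurable. -/
theorem measurable_coinTails (t : ℕ) :
    Measurable fun x : ℕ → Ω × Bool => (if (x t).2 then (0 : ℝ) else 1) := by
  refine Measurable.ite ?_ measurable_const measurable_const
  exact (measurable_snd.comp (measurable_pi_apply _)) (measurableSet_singleton true)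

/-- The tails product `∏_{i<d} 1{coin_{b+i+1} = tails}` is measurable, -/
theorem measurable_tailsProd (b d : ℕ) :
    Measurable fun x : ℕ → Ω × Bool =>
      ∏ i ∈ Finset.range d, (if (x (b + i + 1)).2 then (0 : ℝ) else 1) :=
  Finset.measurable_prod _ fun i _ => measurable_coinTails (b + i + 1)

omit [MeasurableSpace Ω] in
/-- nonnegative, -/
theorem tailsProd_nonneg (b d : ℕ) (x : ℕ → Ω × Bool) :
    0 ≤ ∏ i ∈ Finset.range d, (if (x (b + i + 1)).2 then (0 : ℝ) else 1) :=
  Finset.prod_nonneg fun i _ => by split_ifs <;> norm_num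

omit [MeasurableSpace Ω] in
/-- at most one, -/
theorem tailsProd_le_one (b d : ℕ) (x : ℕ → Ω × Bool) :
    ∏ i ∈ Finset.range d, (if (x (b + i + 1)).2 then (0 : ℝ) else 1) ≤ 1 :=
  Finset.prod_le_one (fun i _ => by split_ifs <;> norm_num) fun i _ => by split_ifs <;> norm_num

omit [MeasurableSpace Ω] in
/-- depends only on times `≤ b + d`, -/
theorem dependsOn_tailsProd (b d : ℕ) :
    DependsOn (fun x : ℕ → Ω × Bool =>
      ∏ i ∈ Finset.range d, (if (x (b + i + 1)).2 then (0 : ℝ) else 1)) (Set.Iic (b + d)) := by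
  intro x y hxy
  refine Finset.prod_congr rfl fun i hi => ?_
  have hi' : b + i + 1 ≤ b + d := by have := Finset.mem_range.1 hi; omega
  rw [hxy (b + i + 1) (Set.mem_Iic.2 hi')]

omit [MeasurableSpace Ω] in
/-- and splits off its FIRST factor: `T_{b,g+1} = 1{coin_{b+1} = tails} · T_{b+1,g}`. -/
theorem tailsProd_succ_first (b g : ℕ) (x : ℕ → Ω × Bool) :
    ∏ i ∈ Finset.range (g + 1), (if (x (b + i + 1)).2 then (0 : ℝ) else 1)
      = (if (x (b + 1)).2 then (0 : ℝ) else 1)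
        * ∏ i ∈ Finset.range g, (if (x (b + 1 + i + 1)).2 then (0 : ℝ) else 1) := by
  rw [Finset.prod_range_succ', mul_comm]
  congr 1
  refine Finset.prod_congr rfl fun i _ => ?_
  rw [show b + (i + 1) + 1 = b + 1 + i + 1 by omega]

end Bookkeeping

/-! ### The split chain: tails runs and the gap lemma -/

section Gaps

variable {κ : Kernel Ω Ω} [IsMarkovKernel κ] {ν : Measure Ω} [IsProbabilityMeasure ν] {ε : ℝ≥0∞}
  {hmin : ∀ x {B : Set Ω}, MeasurableSet B → ε * ν B ≤ κ x B}
  (κs : Kernel (Ω × Bool) (Ω × Bool)) [IsMarkovKernel κs]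
  (μs : Measure (Ω × Bool)) [IsProbabilityMeasure μs]

/-- **NO REGENERATION IN `d` CONSECUTIVE UPDATES HAS WEIGHT `(1 − ε)^d` GIVEN ANY PAST**: for
bounded measurable `G` with `DependsOn G (Set.Iic b)`,
`E[G(X̂) · ∏_{i<d} 1{coin_{b+i+1} = tails}] = (1 − e)^d · E[G(X̂)]`. -/
theorem splitChain_tailsRun (hε : ε < 1)
    (hκs : ∀ p, κs p = (ε • ν).map (fun y : Ω => (y, true))
      + ((1 - ε) • Doeblin.residualKernel κ ν ε hmin p.1).map (fun y : Ω => (y, false)))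
    (b : ℕ) {G : (ℕ → Ω × Bool) → ℝ} (hG : Measurable G) (hGd : DependsOn G (Set.Iic b))
    {CG : ℝ} (hCG : ∀ x, |G x| ≤ CG) :
    ∀ d : ℕ, ∫ x, G x * ∏ i ∈ Finset.range d, (if (x (b + i + 1)).2 then (0 : ℝ) else 1)
        ∂(Kernel.trajMeasure (X := fun _ : ℕ => Ω × Bool) μs
          (fun n : ℕ => κs.comap (fun h : (i : ↥(Finset.Iic n)) → Ω × Bool =>
            h ⟨n, Finset.mem_Iic.2 le_rfl⟩) (measurable_pi_apply _)))
      = (1 - ε.toReal) ^ d * ∫ x, G x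
        ∂(Kernel.trajMeasure (X := fun _ : ℕ => Ω × Bool) μs
          (fun n : ℕ => κs.comap (fun h : (i : ↥(Finset.Iic n)) → Ω × Bool =>
            h ⟨n, Finset.mem_Iic.2 le_rfl⟩) (measurable_pi_apply _)))
  | 0 => by simp
  | d + 1 => by
    have hG' : Measurable fun x : ℕ → Ω × Bool =>
        G x * ∏ i ∈ Finset.range d, (if (x (b + i + 1)).2 then (0 : ℝ) else 1) :=
      hG.mul (measurable_tailsProd b d)
    have hG'd : DependsOn (fun x : ℕ → Ω × Bool =>
        G x * ∏ i ∈ Finset.range d, (if (x (b + i + 1)).2 then (0 : ℝ) else 1))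
        (Set.Iic (b + d)) := by
      intro x y hxy
      show G x * _ = G y * _
      rw [hGd (fun i hi => hxy i (Set.Iic_subset_Iic.2 (Nat.le_add_right b d) hi))]
      congr 1
      exact dependsOn_tailsProd b d hxy
    have hCG' : ∀ x : ℕ → Ω × Bool,
        |G x * ∏ i ∈ Finset.range d, (if (x (b + i + 1)).2 then (0 : ℝ) else 1)| ≤ CG := fun x => by
      rw [abs_mul, abs_of_nonneg (tailsProd_nonneg b d x)]
      calc |G x| * _ ≤ |G x| * 1 := mul_le_mul_of_nonneg_left (tailsProd_le_one b d x) (abs_nonneg _)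
        _ ≤ CG := by rw [mul_one]; exact hCG x
    have step := splitChain_tails_dependsOn κs μs (κ := κ) (ν := ν) (hmin := hmin) hε hκs (b + d)
      hG' hG'd hCG'
    simp_rw [Finset.prod_range_succ, ← mul_assoc]
    rw [step, splitChain_tailsRun hε hκs b hG hGd hCG d, pow_succ]
    ring

/-- **THE GAP LEMMA (with the exact factor).**  `G ≥ 0` bounded measurable with
`DependsOn G (Set.Iic b)`; `H ≥ 0` bounded measurable on state paths; `q` with
`E_{P_{ν,κ}}[H((y_{e+n})_n)] ≤ q` for every delay `1 ≤ e ≤ g`; `s = b + g + 1`.  Then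
`E[G(X̂) · (1 − ∏_{i<g} 1{coin_{b+i+1} = tails}) · H((X_{s+n})_n)] ≤ q · (1 − (1 − e)^g) · E[G(X̂)]`. -/
theorem splitChain_gap_le' (hε : ε < 1)
    (hκs : ∀ p, κs p = (ε • ν).map (fun y : Ω => (y, true))
      + ((1 - ε) • Doeblin.residualKernel κ ν ε hmin p.1).map (fun y : Ω => (y, false)))
    {H : (ℕ → Ω) → ℝ} (hH : Measurable H) {CH : ℝ} (hHC : ∀ y, H y ≤ CH) (hH0 : ∀ y, 0 ≤ H y)
    {q : ℝ} :
    ∀ (g b s : ℕ), s = b + g + 1 →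
      (∀ e : ℕ, 1 ≤ e → e ≤ g → ∫ y, H (fun n => y (e + n))
        ∂(Kernel.trajMeasure (X := fun _ : ℕ => Ω) ν
          (fun n : ℕ => κ.comap (fun h : (i : ↥(Finset.Iic n)) → Ω => h ⟨n, Finset.mem_Iic.2 le_rfl⟩)
            (measurable_pi_apply _))) ≤ q) →
      ∀ {G : (ℕ → Ω × Bool) → ℝ}, Measurable G → DependsOn G (Set.Iic b) → ∀ {CG : ℝ},
        (∀ x, G x ≤ CG) → (∀ x, 0 ≤ G x) →
      ∫ x, G x * (1 - ∏ i ∈ Finset.range g, (if (x (b + i + 1)).2 then (0 : ℝ) else 1))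
          * H (fun n => (x (s + n)).1)
        ∂(Kernel.trajMeasure (X := fun _ : ℕ => Ω × Bool) μs
          (fun n : ℕ => κs.comap (fun h : (i : ↥(Finset.Iic n)) → Ω × Bool =>
            h ⟨n, Finset.mem_Iic.2 le_rfl⟩) (measurable_pi_apply _)))
      ≤ q * (1 - (1 - ε.toReal) ^ g) * ∫ x, G x
        ∂(Kernel.trajMeasure (X := fun _ : ℕ => Ω × Bool) μs
          (fun n : ℕ => κs.comap (fun h : (i : ↥(Finset.Iic n)) → Ω × Bool =>
            h ⟨n, Finset.mem_Iic.2 le_rfl⟩) (measurable_pi_apply _))) := by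
  set P := Kernel.trajMeasure (X := fun _ : ℕ => Ω × Bool) μs
      (fun n : ℕ => κs.comap (fun h : (i : ↥(Finset.Iic n)) → Ω × Bool =>
        h ⟨n, Finset.mem_Iic.2 le_rfl⟩) (measurable_pi_apply _)) with hP
  intro g
  induction g with
  | zero =>
    intro b s hs hq G hG hGd CG hCG hG0
    simp only [Finset.range_zero, Finset.prod_empty, sub_self, mul_zero, zero_mul, integral_zero,
      pow_zero]
    exact le_refl _
  | succ g ih =>
    intro b s hs hq G hG hGd CG hCG hG0
    have hCGabs : ∀ x, |G x| ≤ CG := fun x => by rw [abs_of_nonneg (hG0 x)]; exact hCG x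
    have hCG0 : 0 ≤ CG := (hG0 (fun _ => Classical.choice
      (nonempty_of_isProbabilityMeasure μs))).trans (hCG _)
    -- the state-path functional seen from time `s`
    have hθ : ∀ t : ℕ, Measurable fun (x : ℕ → Ω × Bool) (n : ℕ) => (x (t + n)).1 := fun t =>
      measurable_pi_lambda _ fun n => measurable_fst.comp (measurable_pi_apply _)
    have hHs : Measurable fun x : ℕ → Ω × Bool => H (fun n => (x (s + n)).1) := hH.comp (hθ s)
    -- split off the first coin of the gap
    have hsplit : ∀ x : ℕ → Ω × Bool,
        G x * (1 - ∏ i ∈ Finset.range (g + 1), (if (x (b + i + 1)).2 then (0 : ℝ) else 1))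
          * H (fun n => (x (s + n)).1)
        = G x * (if (x (b + 1)).2 then (1 : ℝ) else 0) * H (fun n => (x (s + n)).1)
          + (G x * (if (x (b + 1)).2 then (0 : ℝ) else 1))
            * (1 - ∏ i ∈ Finset.range g, (if (x (b + 1 + i + 1)).2 then (0 : ℝ) else 1))
            * H (fun n => (x (s + n)).1) := fun x => by
      rw [tailsProd_succ_first]
      split_ifs <;> ring
    -- first term: a head at `b + 1`, then the block is the fresh chain seen with delay `g + 1`
    have hT1 : ∫ x, G x * (if (x (b + 1)).2 then (1 : ℝ) else 0) * H (fun n => (x (s + n)).1) ∂P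
        ≤ ε.toReal * q * ∫ x, G x ∂P := by
      have hshift : ∀ x : ℕ → Ω × Bool, H (fun n => (x (s + n)).1)
          = (fun y : ℕ → Ω => H (fun n => y (g + 1 + n))) (fun n => (x (b + 1 + n)).1) := fun x => by
        simp only
        congr 1
        funext n
        rw [show s + n = b + 1 + (g + 1 + n) by omega]
      simp_rw [hshift]
      rw [hP, splitChain_regeneration_stateIntegral_dependsOn κs μs (κ := κ) (ν := ν) (hmin := hmin)
        hε hκs b hG hGd hCGabs hG0 (H := fun y : ℕ → Ω => H (fun n => y (g + 1 + n)))
        (hH.comp (measurable_pi_lambda _ fun n => measurable_pi_apply _)), ← hP]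
      have hI0 : 0 ≤ ∫ x, G x ∂P := integral_nonneg hG0
      have := hq (g + 1) (Nat.le_add_left 1 g) le_rfl
      calc ε.toReal * (∫ x, G x ∂P) * _ ≤ ε.toReal * (∫ x, G x ∂P) * q :=
            mul_le_mul_of_nonneg_left this (mul_nonneg ENNReal.toReal_nonneg hI0)
        _ = ε.toReal * q * ∫ x, G x ∂P := by ring
    -- second term: tails at `b + 1`, induction hypothesis from time `b + 1` with the weight
    -- `G · 1{tails}`
    have hG' : Measurable fun x : ℕ → Ω × Bool => G x * (if (x (b + 1)).2 then (0 : ℝ) else 1) :=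
      hG.mul (measurable_coinTails (b + 1))
    have hG'd : DependsOn (fun x : ℕ → Ω × Bool => G x * (if (x (b + 1)).2 then (0 : ℝ) else 1))
        (Set.Iic (b + 1)) := by
      intro x y hxy
      show G x * _ = G y * _
      rw [hGd (fun i hi => hxy i (Set.Iic_subset_Iic.2 (Nat.le_succ b) hi)),
        hxy (b + 1) (Set.mem_Iic.2 le_rfl)]
    have hCG' : ∀ x : ℕ → Ω × Bool, G x * (if (x (b + 1)).2 then (0 : ℝ) else 1) ≤ CG := fun x => by
      split_ifs
      · rw [mul_zero]; exact hCG0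
      · rw [mul_one]; exact hCG x
    have hG'0 : ∀ x : ℕ → Ω × Bool, 0 ≤ G x * (if (x (b + 1)).2 then (0 : ℝ) else 1) := fun x => by
      split_ifs
      · rw [mul_zero]
      · rw [mul_one]; exact hG0 x
    have hT2 : ∫ x, (G x * (if (x (b + 1)).2 then (0 : ℝ) else 1))
          * (1 - ∏ i ∈ Finset.range g, (if (x (b + 1 + i + 1)).2 then (0 : ℝ) else 1))
          * H (fun n => (x (s + n)).1) ∂P
        ≤ q * (1 - (1 - ε.toReal) ^ g) * ((1 - ε.toReal) * ∫ x, G x ∂P) := by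
      have h := ih (b + 1) s (by omega) (fun e he1 heg => hq e he1 (heg.trans (Nat.le_succ g)))
        hG' hG'd hCG' hG'0
      rw [hP, splitChain_tails_dependsOn κs μs (κ := κ) (ν := ν) (hmin := hmin) hε hκs b hG hGd
        hCGabs, ← hP] at h
      exact h
    -- integrability of the two pieces
    have hHabs : ∀ x : ℕ → Ω × Bool, |H (fun n => (x (s + n)).1)| ≤ CH := fun x => by
      rw [abs_of_nonneg (hH0 _)]; exact hHC _
    have hCH0 : 0 ≤ CH := (hH0 (fun _ => Classical.choice
      (nonempty_of_isProbabilityMeasure ν))).trans (hHC _)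
    have hi1 : Integrable (fun x : ℕ → Ω × Bool =>
        G x * (if (x (b + 1)).2 then (1 : ℝ) else 0) * H (fun n => (x (s + n)).1)) P := by
      refine integrable_of_bounded P ((hG.mul (measurable_coinHeads (b + 1))).mul hHs)
        (C := CG * 1 * CH) fun x => ?_
      rw [abs_mul, abs_mul]
      refine mul_le_mul (mul_le_mul (hCGabs x) ?_ (abs_nonneg _) hCG0) (hHabs x) (abs_nonneg _)
        (mul_nonneg hCG0 zero_le_one)
      split_ifs <;> simp
    have hi2 : Integrable (fun x : ℕ → Ω × Bool =>
        (G x * (if (x (b + 1)).2 then (0 : ℝ) else 1))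
          * (1 - ∏ i ∈ Finset.range g, (if (x (b + 1 + i + 1)).2 then (0 : ℝ) else 1))
          * H (fun n => (x (s + n)).1)) P := by
      refine integrable_of_bounded P ((hG'.mul (measurable_const.sub
        (measurable_tailsProd (b + 1) g))).mul hHs) (C := CG * 1 * CH) fun x => ?_
      rw [abs_mul, abs_mul]
      refine mul_le_mul (mul_le_mul ?_ ?_ (abs_nonneg _) hCG0) (hHabs x) (abs_nonneg _)
        (mul_nonneg hCG0 zero_le_one)
      · rw [abs_of_nonneg (hG'0 x)]; exact hCG' x
      · rw [abs_of_nonneg (sub_nonneg.2 (tailsProd_le_one (b + 1) g x))]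
        exact sub_le_self _ (tailsProd_nonneg (b + 1) g x)
    -- assemble
    have hI0 : 0 ≤ ∫ x, G x ∂P := integral_nonneg hG0
    have he0 : 0 ≤ ε.toReal := ENNReal.toReal_nonneg
    have he1 : ε.toReal ≤ 1 := by
      have := (ENNReal.toReal_lt_toReal (ne_top_of_lt hε) ENNReal.one_ne_top).2 hε
      rw [ENNReal.toReal_one] at this
      exact this.le
    simp_rw [hsplit]
    rw [integral_add hi1 hi2]
    calc _ ≤ ε.toReal * q * ∫ x, G x ∂P
          + q * (1 - (1 - ε.toReal) ^ g) * ((1 - ε.toReal) * ∫ x, G x ∂P) := add_le_add hT1 hT2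
      _ = q * (1 - (1 - ε.toReal) ^ (g + 1)) * ∫ x, G x ∂P := by ring

/-- **THE GAP LEMMA.**  Same hypotheses:
`E[G(X̂) · 1{some head among coins b+1, …, b+g} · H((X_{s+n})_n)] ≤ q · E[G(X̂)]` — a block observed
after a gap containing a regeneration is, given any weighted past, no worse than the worst of the
`g` delayed fresh starts from `ν`. -/
theorem splitChain_gap_le (hε : ε < 1)
    (hκs : ∀ p, κs p = (ε • ν).map (fun y : Ω => (y, true))
      + ((1 - ε) • Doeblin.residualKernel κ ν ε hmin p.1).map (fun y : Ω => (y, false)))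
    {H : (ℕ → Ω) → ℝ} (hH : Measurable H) {CH : ℝ} (hHC : ∀ y, H y ≤ CH) (hH0 : ∀ y, 0 ≤ H y)
    {q : ℝ} (hq0 : 0 ≤ q) {g b s : ℕ} (hs : s = b + g + 1)
    (hq : ∀ e : ℕ, 1 ≤ e → e ≤ g → ∫ y, H (fun n => y (e + n))
        ∂(Kernel.trajMeasure (X := fun _ : ℕ => Ω) ν
          (fun n : ℕ => κ.comap (fun h : (i : ↥(Finset.Iic n)) → Ω => h ⟨n, Finset.mem_Iic.2 le_rfl⟩)
            (measurable_pi_apply _))) ≤ q)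
    {G : (ℕ → Ω × Bool) → ℝ} (hG : Measurable G) (hGd : DependsOn G (Set.Iic b)) {CG : ℝ}
    (hCG : ∀ x, G x ≤ CG) (hG0 : ∀ x, 0 ≤ G x) :
    ∫ x, G x * (1 - ∏ i ∈ Finset.range g, (if (x (b + i + 1)).2 then (0 : ℝ) else 1))
          * H (fun n => (x (s + n)).1)
        ∂(Kernel.trajMeasure (X := fun _ : ℕ => Ω × Bool) μs
          (fun n : ℕ => κs.comap (fun h : (i : ↥(Finset.Iic n)) → Ω × Bool =>
            h ⟨n, Finset.mem_Iic.2 le_rfl⟩) (measurable_pi_apply _)))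
      ≤ q * ∫ x, G x
        ∂(Kernel.trajMeasure (X := fun _ : ℕ => Ω × Bool) μs
          (fun n : ℕ => κs.comap (fun h : (i : ↥(Finset.Iic n)) → Ω × Bool =>
            h ⟨n, Finset.mem_Iic.2 le_rfl⟩) (measurable_pi_apply _))) := by
  have h := splitChain_gap_le' κs μs (κ := κ) (ν := ν) (hmin := hmin) hε hκs hH hHC hH0 g b s
    hs hq hG hGd hCG hG0
  refine h.trans ?_
  have hI0 : 0 ≤ ∫ x, G x ∂(Kernel.trajMeasure (X := fun _ : ℕ => Ω × Bool) μs
      (fun n : ℕ => κs.comap (fun h : (i : ↥(Finset.Iic n)) → Ω × Bool =>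
        h ⟨n, Finset.mem_Iic.2 le_rfl⟩) (measurable_pi_apply _))) := integral_nonneg hG0
  have he0 : 0 ≤ 1 - ε.toReal := by
    have := (ENNReal.toReal_lt_toReal (ne_top_of_lt hε) ENNReal.one_ne_top).2 hε
    rw [ENNReal.toReal_one] at this
    linarith
  have hfac : q * (1 - (1 - ε.toReal) ^ g) ≤ q := by
    have : 0 ≤ (1 - ε.toReal) ^ g := pow_nonneg he0 g
    nlinarith
  exact mul_le_mul_of_nonneg_right hfac hI0

end Gaps

end Summit.Ventures.LatticeQCDFlow.Scoring

end
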